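import Summits.ResolutionOfSingularities.ResolutionOfSingularities.Theorems.FrobeniusLadderFInjectiveMacaulayficationFCForallExistsDimLe2
import Literature.AlgebraicGeometry.Resolution.BlowupsComposition
import Literature.AlgebraicGeometry.Resolution.BlowupsProduct
import Literature.AlgebraicGeometry.Resolution.BlowupsIntegral
import Literature.AlgebraicGeometry.Resolution.BlowupsProperProofs
import Literature.AlgebraicGeometry.Resolution.KollarBlowupSequenceFunctors
import Mathlib.AlgebraicGeometry.Morphisms.Finite
import Mathlib.AlgebraicGeometry.Noetherian
import HarnessLib

/-!
# A finite modification of a blowing up (stalk-iso off the centre) is a blowing up with the same support — S-V of the FC′ r2 rung,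
# reduced SORRY-FREE to two affine-local statements S-V1 (conductor power bound) and S-V2 (finite birational = blow-up of a stable ideal)
# (crux `FInjectiveMacaulayfication` stmt-ResolutionOfSingularities-15315, chain w45a, hole #3γ; res-L1-w45a-plan-1 R13.25 (2);
# text res-L1-w45a-strat-1 `FCRungsSig.lean` v2.4 §B8, filer res-D-pv-019 (stub-7))

[OURS · L1 W4.5a] Support file (`--supports stmt-ResolutionOfSingularities-15315 --as helper`); NOT a statement of any manuscript; no named
fact introduced; AI-written (AI review is weaker than expert review). Proves
`finiteModificationOfBlowupIsBlowup_of : ConductorIdealExists → IsBlowupOfFiniteOfStable → FCForallExistsDimLe2.FiniteModificationOfBlowupIsBlowup`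
where the two inputs are declared as `@[conjecture] def`s (folklore, believed true; to be proved in follow-up files):
S-V1 `ConductorIdealExists` and S-V2 `IsBlowupOfFiniteOfStable`. The glue is Stacks 080A/080B AS LANDED in the tree
(`IsBlowup.exists_isBlowup_comp_supported`, `IsBlowup.comp`, `IsBlowup.id`, `IsEffectiveCartier.comap_of_isBlowup`) plus support bookkeeping;
the witness centre is `J := Q·J₀`. NO quasi-projectivity is used (contrast Hartshorne II.7.17 / Liu 8.1.24).

ROUTE OF THE PROOF.

ROUTE. Let `I := J₀𝒪_{X₂}` (`J₀.comap π`), an effective Cartier divisor on `X₂ = Bl_{J₀} X₁` whose support contains the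
non-isomorphism locus of the finite birational `g : X₃ → X₂`.
(S-V1) For `N ≫ 0` the ideal `𝔠 := 𝒪_{X₂} ∩ Iᴺ·g_*𝒪_{X₃} = Iᴺ·g_*𝒪_{X₃}` is a non-zero ideal of `𝒪_{X₂}` with
`Supp 𝔠 = Supp I`, STABLE under `g_*𝒪_{X₃}`, and `𝔠𝒪_{X₃} = (I𝒪_{X₃})ᴺ` is an effective Cartier divisor (conductor
bound: `B/A` is a finitely generated `A`-module supported in `V(I)` because `B_𝔭 = A_𝔭` off `V(I)` — a domain is the
intersection of its localisations at maximal ideals — hence `Iᴺ ⊆ Ann_A(B/A)`; uniform `N` by quasi-compactness;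
`Supp 𝔠 ⊇ Supp I` by Nakayama).
(S-V2) A finite birational `g` is a blowing up of `X₂` along ANY `g_*𝒪_{X₃}`-stable ideal `𝔠` with `𝔠𝒪_{X₃}` effective
Cartier: affine-locally `Spec B → Spec A` with `𝔠B = 𝔠`; a morphism `f : W → Spec A` with `𝔠𝒪_W = (f♯x)` invertible
(`x ∈ 𝔠` a local generator) extends UNIQUELY to `B` by `b ↦ f♯(a)/f♯(x)` where `a ∈ 𝔠` is the element with `a = b·x`
(stability); glue with `IsBlowup.of_openCover`.
Then `g ≫ π` is a blowing up of `X₁` along some `Q` with `Supp Q ⊆ Supp J₀` (Stacks 080A/080B in the tree: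
`IsBlowup.exists_isBlowup_comp_supported`), hence also along `Q·J₀` (`IsBlowup.comp` with the identity blow-up
`IsBlowup.id` of the effective Cartier divisor `J₀𝒪_{X₃}`), whose support is exactly `Supp J₀`; `Q·J₀ ≠ 0` because
`Supp J₀ ≠ X₁`. NO quasi-projectivity of `X₁` is used (contrast Hartshorne II.7.17 / Liu 8.1.24).

[folklore assembly; cite: StacksProject, Tags 080A, 080B, 0804, 0805; EGAII, 8.1.3; Liu2002, §8.1]
-/

-- single-problem summit: the doubled namespace component is forced
set_option linter.dupNamespace false

noncomputable section

open AlgebraicGeometry CategoryTheory Literature.AlgebraicGeometry.Resolution TopologicalSpace IsLocalRing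
open Scheme.IdealSheafData

namespace Summit.ResolutionOfSingularities.ResolutionOfSingularities.Theorems.FInjectiveMacaulayfication.FiniteModificationOfBlowup

open Summit.ResolutionOfSingularities.ResolutionOfSingularities.Theorems.FInjectiveMacaulayfication
open Summit.ResolutionOfSingularities.ResolutionOfSingularities.Theorems.FInjectiveMacaulayfication.FCForallExistsDimLe2

/-- **S-V1 — conductor power bound (typed input, OURS candidate).** For a finite surjective morphism `g : X₃ → X₂` of
integral schemes, `X₂` Noetherian, which is a stalk-isomorphism off the support of a non-zero effective Cartier divisor `I`
on `X₂`, there is a non-zero ideal sheaf `𝔠` on `X₂` with `Supp 𝔠 = Supp I`, with `𝔠𝒪_{X₃}` an effective Cartier divisor,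
and STABLE under `g_*𝒪_{X₃}`: on every affine open `U = Spec A` of `X₂` (so `g⁻¹U = Spec B`), `B·𝔠(U) = 𝔠(U)`, i.e.
every element of the extended ideal is the image of an element of `𝔠(U)`. Intended witness: `𝔠(U) = A ∩ IᴺB = IᴺB` for
`N ≫ 0` (as an ideal sheaf: the kernel of `𝒪_{X₂} → g_*(𝒪_{X₃}/(I𝒪_{X₃})ᴺ)`). Why it might fail: only by mis-typing —
the stability clause is asserted for ALL affine opens, which is a local statement inherited from one finite affine cover.
[folklore: conductor of a finite birational extension is non-zero and cosupported on the non-isomorphism locus; OURS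
assembly] -/
@[conjecture] def ConductorIdealExists : Prop :=
  ∀ (X₂ X₃ : Scheme.{0}) (g : X₃ ⟶ X₂) (I : X₂.IdealSheafData),
    IsIntegral X₂ → IsNoetherian X₂ → IsIntegral X₃ → IsFinite g → Function.Surjective g.base →
    I ≠ ⊥ → IsEffectiveCartier I →
    (∀ x₃ : X₃, g.base x₃ ∉ (I.support : Set X₂) → IsIso (g.stalkMap x₃)) →
    ∃ 𝔠 : X₂.IdealSheafData, 𝔠 ≠ ⊥ ∧ 𝔠.support = I.support ∧ IsEffectiveCartier (𝔠.comap g) ∧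
      ∀ (U : X₂.affineOpens) (b : Γ(X₃, g ⁻¹ᵁ (U : X₂.Opens))),
        b ∈ Ideal.map (g.app (U : X₂.Opens)).hom (𝔠.ideal U) →
          ∃ a ∈ 𝔠.ideal U, (g.app (U : X₂.Opens)).hom a = b

/-- **S-V2 — a finite birational morphism is a blowing up along every stable ideal it inverts (typed input, OURS
candidate).** If `g : X₃ → X₂` is finite surjective between integral schemes, a stalk-isomorphism off `Supp 𝔠` for a
non-zero ideal sheaf `𝔠` on `X₂` which is `g_*𝒪_{X₃}`-stable (as in S-V1) and whose extension `𝔠𝒪_{X₃}` is an effective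
Cartier divisor, then `g` is a blowing up of `X₂` along `𝔠` in the sense of the universal property `IsBlowup`.
Proof intended: affine-locally on `X₂` (`IsBlowup.of_openCover`), for `f : W → Spec A` with `𝔠𝒪_W` invertible, locally
generated by `f♯(x)`, `x ∈ 𝔠(U)`, the unique extension `B → Γ(W')` is `b ↦ q` with `q·f♯(x) = f♯(a)`, `a := b·x ∈ 𝔠(U)`
(stability; `f♯(x)` regular); uniqueness from regularity of `f♯(x)`. Why it might fail: only by mis-typing (birationality
is in fact not needed for the universal property; it is kept for readability). [folklore: `Spec B = Bl_𝔠 Spec A` for a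
`B`-invertible `B`-ideal `𝔠 ⊆ A`; OURS assembly] -/
@[conjecture] def IsBlowupOfFiniteOfStable : Prop :=
  ∀ (X₂ X₃ : Scheme.{0}) (g : X₃ ⟶ X₂) (𝔠 : X₂.IdealSheafData),
    IsIntegral X₂ → IsIntegral X₃ → IsFinite g → Function.Surjective g.base → 𝔠 ≠ ⊥ →
    (∀ x₃ : X₃, g.base x₃ ∉ (𝔠.support : Set X₂) → IsIso (g.stalkMap x₃)) →
    IsEffectiveCartier (𝔠.comap g) →
    (∀ (U : X₂.affineOpens) (b : Γ(X₃, g ⁻¹ᵁ (U : X₂.Opens))),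
        b ∈ Ideal.map (g.app (U : X₂.Opens)).hom (𝔠.ideal U) →
          ∃ a ∈ 𝔠.ideal U, (g.app (U : X₂.Opens)).hom a = b) →
    IsBlowup g 𝔠

/-- The source of a blowing up of a Noetherian scheme is Noetherian (local copy of
`Literature…isNoetherian_of_isBlowup`: proper ⇒ locally of finite type and quasi-compact). [folklore] -/
theorem isNoetherian_of_isBlowup' {S₁ S : Scheme.{0}} [IsNoetherian S] {φ : S₁ ⟶ S}
    {I : S.IdealSheafData} (hφ : IsBlowup φ I) : IsNoetherian S₁ := by
  haveI : IsProper φ := hφ.isProper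
  haveI : IsLocallyNoetherian S₁ := LocallyOfFiniteType.isLocallyNoetherian φ
  haveI : CompactSpace S₁ := QuasiCompact.compactSpace_of_compactSpace φ
  exact {}

/-- **KERNEL (S-V), SORRY-FREE: `ConductorIdealExists → IsBlowupOfFiniteOfStable → FiniteModificationOfBlowupIsBlowup`.**
The glue is Stacks 080A/080B as landed in the tree (`IsBlowup.exists_isBlowup_comp_supported`, `IsBlowup.comp`,
`IsBlowup.id`, `IsEffectiveCartier.comap_of_isBlowup`) plus support bookkeeping; the witness is `J := Q·J₀`.
[OURS assembly; cite: StacksProject, Tags 080A and 080B] -/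
theorem finiteModificationOfBlowupIsBlowup_of (h1 : ConductorIdealExists) (h2 : IsBlowupOfFiniteOfStable) :
    FiniteModificationOfBlowupIsBlowup := by
  intro X₁ X₂ X₃ J₀ π g hint hnoeth hJ₀ hp hint₃ hfin hsurj hiso
  haveI := hint; haveI := hnoeth; haveI := hint₃; haveI := hfin
  haveI : IsIntegral X₂ := hp.isIntegral hJ₀
  haveI : IsNoetherian X₂ := isNoetherian_of_isBlowup' hp
  -- the exceptional divisor `I := J₀𝒪_{X₂}`
  have hI : IsEffectiveCartier (J₀.comap π) := hp.isEffectiveCartier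
  have hmem : ∀ x₂ : X₂, x₂ ∈ ((J₀.comap π).support : Set X₂) ↔ π.base x₂ ∈ (J₀.support : Set X₁) := by
    intro x₂
    rw [Scheme.IdealSheafData.support_comap]
    rfl
  have hIne : J₀.comap π ≠ ⊥ := by
    intro h
    obtain ⟨y, hy⟩ := hp.dense_preimage_compl.nonempty
    have hy' : π.base y ∉ (J₀.support : Set X₁) := hy
    have hyI : y ∈ ((J₀.comap π).support : Set X₂) := by
      rw [h, Scheme.IdealSheafData.support_bot]
      trivial
    exact hy' ((hmem y).mp hyI)
  have hisoI : ∀ x₃ : X₃, g.base x₃ ∉ ((J₀.comap π).support : Set X₂) → IsIso (g.stalkMap x₃) :=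
    fun x₃ hx₃ => hiso x₃ (fun h => hx₃ ((hmem _).mpr h))
  -- S-V1: the stable ideal `𝔠 = Iᴺ g_*𝒪_{X₃}`
  obtain ⟨𝔠, h𝔠ne, h𝔠supp, h𝔠cart, h𝔠stab⟩ :=
    h1 X₂ X₃ g (J₀.comap π) inferInstance inferInstance inferInstance hfin hsurj hIne hI hisoI
  have hiso𝔠 : ∀ x₃ : X₃, g.base x₃ ∉ (𝔠.support : Set X₂) → IsIso (g.stalkMap x₃) := by
    intro x₃ hx₃
    apply hisoI
    rwa [← h𝔠supp]
  -- S-V2: `g` blows up `𝔠`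
  have hg : IsBlowup g 𝔠 := h2 X₂ X₃ g 𝔠 inferInstance inferInstance hfin hsurj h𝔠ne hiso𝔠 h𝔠cart h𝔠stab
  -- Stacks 080B: `g ≫ π` blows up some `Q` supported in `Supp J₀`
  obtain ⟨Q, hQ, hQsupp⟩ := IsBlowup.exists_isBlowup_comp_supported π J₀ g 𝔠 (J₀.support : Set X₁) hp
    subset_rfl hg (by
      intro x₂ hx₂
      have hx₂' : x₂ ∈ ((J₀.comap π).support : Set X₂) := by rwa [← h𝔠supp]
      exact (hmem x₂).mp hx₂')
  -- twist: `g ≫ π` also blows up `Q · J₀`, since `J₀𝒪_{X₃}` is already an effective Cartier divisor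
  have hEC : IsEffectiveCartier (J₀.comap (g ≫ π)) := by
    rw [Scheme.IdealSheafData.comap_comp]
    exact hI.comap_of_isBlowup hg
  have hJ : IsBlowup (g ≫ π) (Q * J₀) := by
    have h := IsBlowup.comp hQ (IsBlowup.id hEC)
    simpa only [Category.id_comp] using h
  have hQle : Q.support ≤ J₀.support := fun x hx => hQsupp hx
  have hsupp : (Q * J₀).support = J₀.support := by
    rw [Scheme.IdealSheafData.support_mul]
    exact sup_eq_right.mpr hQle
  refine ⟨Q * J₀, ?_, hsupp, hJ⟩
  intro h
  have hs : (Q * J₀).support = ⊤ := by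
    rw [h, Scheme.IdealSheafData.support_bot]
  rw [hsupp] at hs
  exact hJ₀ (Scheme.IdealSheafData.support_eq_top_iff.mp hs)

end Summit.ResolutionOfSingularities.ResolutionOfSingularities.Theorems.FInjectiveMacaulayfication.FiniteModificationOfBlowup

end
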